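import Literature.Computability.Cryptography.HallgrenCombTable
import Literature.Computability.Cryptography.InfrastructureNavigation
import HarnessLib

/-!
# The computed table of the infrastructure walk is a blurred gap table

Topic `Computability/Cryptography`; brick of the discharge of
`Literature.Computability.Cryptography.Hallgren2007_regulator_qsolvable_delim` (`HallgrenPell.lean`),
joining `InfrastructureNavigation.lean` (the walk of Jozsa 2003, Thm. 5, with rational
approximations: `GiantStepCycle`, `WalkData.table`, `table_blur`, `table_exact`,
`final_eq_of_generic_grid`) to `HallgrenCombTable.lean` (the comb structure of a `BlurredGapTable`,
Jozsa 2003, Prop. 36 made honest). Theorem-and-definition file, no named facts.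

For an abstract infrastructure `G : GiantStepCycle ι`, a mesh `N ≥ 1`, walk parameters `s₀, T, M`
and a range bound `V` with `V/N ≤ d̂(I_T)` and `M(L − 2η) > Res` (adequate parameters in the sense
of `InfrastructureNavigation.lean`), we construct

* `GiantStepCycle.blurred …` — a `BlurredGapTable ι` with pitch `S = N R`, positions `N · P`,
  labels `lab`, blur radius `e = N E_tot`, anchor tolerance `w = N E_tot + 1`, whose table agrees
  with the computed `G.table N s₀ T (2M)` on `[0, V]` (`blurred_F_of_mem`; outside that window it is
  extended by the canonical values, irrelevant for the Fourier sampling on `[0, Q)`, `Q ≤ V + 1`),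

so that every conclusion of `HallgrenCombTable.lean` — exact comb level sets through good starts,
injectivity on good starts, the `[0, Q)` packaging and the bad-start count — holds for the table
Hallgren's algorithm actually computes: `table_filter_range_eq_image`, `table_injOn_of_good`,
`table_abs_tooth_sub_le`.

## References

* R. Jozsa, *Notes on Hallgren's efficient quantum algorithm for solving Pell's equation*,
  arXiv:quant-ph/0302134 (2003), §9 Thm. 5, §10 Prop. 36. [Jozsa2003]
-/

noncomputable section

open Finset
open scoped Classical

namespace Literature.Computability.Cryptography

namespace GiantStepCycle

open WalkData

variable {ι : Type*} (G : GiantStepCycle ι)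

/-! ### Scaled stretches -/

/-- Every grid point lies in a unique scaled stretch `[N P m, N P (m+1))`. [folklore] -/
theorem exists_gridStretch {N : ℕ} (hN : 0 < N) (v : ℤ) :
    ∃ m, (N : ℝ) * G.P m ≤ v ∧ (v : ℝ) < N * G.P (m + 1) := by
  have hNr : (0 : ℝ) < N := by exact_mod_cast hN
  have hR : 0 < G.R := by
    have h := G.periodic 0
    have hn : (0 : ℤ) < (G.n : ℤ) := by exact_mod_cast G.n_pos
    have := G.strictMono hn
    rw [zero_add] at h; linarith
  -- positions are unbounded in both directions
  obtain ⟨l₁, hl₁⟩ := exists_nat_gt (((v : ℝ) / N - G.P 0) / G.R)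
  obtain ⟨l₂, hl₂⟩ := exists_nat_gt ((G.P 0 - (v : ℝ) / N) / G.R)
  rw [div_lt_iff₀ hR] at hl₁ hl₂
  have hup : (v : ℝ) / N < G.P (0 + l₁ * G.n) := by rw [G.P_add_mul]; push_cast; linarith
  have hlow : G.P (0 + (-(l₂ : ℤ)) * G.n) ≤ (v : ℝ) / N := by rw [G.P_add_mul]; push_cast; linarith
  have hbdd : ∃ b : ℤ, ∀ z : ℤ, G.P z ≤ (v : ℝ) / N → z ≤ b := by
    refine ⟨0 + l₁ * G.n, fun z hz => ?_⟩
    by_contra hc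
    push Not at hc
    have := G.strictMono hc
    linarith
  obtain ⟨m, hm, hmax⟩ := Int.exists_greatest_of_bdd (P := fun z => G.P z ≤ (v : ℝ) / N) hbdd ⟨_, hlow⟩
  refine ⟨m, ?_, ?_⟩
  · have : G.P m ≤ (v : ℝ) / N := hm
    rw [le_div_iff₀ hNr] at this; linarith
  · by_contra hc
    push Not at hc
    have hc' : G.P (m + 1) ≤ (v : ℝ) / N := by rw [le_div_iff₀ hNr]; linarith
    have := hmax (m + 1) hc'
    omega

/-- The scaled stretch of a grid point (a choice). [folklore] -/
def gridStretch {N : ℕ} (hN : 0 < N) (v : ℤ) : ℤ := Classical.choose (G.exists_gridStretch hN v)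

/-- Specification of `gridStretch`. [folklore] -/
theorem gridStretch_spec {N : ℕ} (hN : 0 < N) (v : ℤ) :
    (N : ℝ) * G.P (G.gridStretch hN v) ≤ v ∧ (v : ℝ) < N * G.P (G.gridStretch hN v + 1) :=
  Classical.choose_spec (G.exists_gridStretch hN v)

/-- Uniqueness of the scaled stretch. [folklore] -/
theorem gridStretch_eq {N : ℕ} (hN : 0 < N) {v m : ℤ} (h1 : (N : ℝ) * G.P m ≤ v)
    (h2 : (v : ℝ) < N * G.P (m + 1)) : G.gridStretch hN v = m := by
  obtain ⟨h1', h2'⟩ := G.gridStretch_spec hN v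
  have hNr : (0 : ℝ) < N := by exact_mod_cast hN
  by_contra hne
  rcases lt_or_gt_of_ne hne with h | h
  · have := G.strictMono.monotone (show G.gridStretch hN v + 1 ≤ m by omega)
    have := mul_le_mul_of_nonneg_left this hNr.le
    linarith
  · have := G.strictMono.monotone (show m + 1 ≤ G.gridStretch hN v by omega)
    have := mul_le_mul_of_nonneg_left this hNr.le
    linarith

/-! ### Reference points and anchors -/

/-- The reference set of stretch `m`: grid points of `[0, V]` inside the scaled stretch and farther
than `N E_tot` from every scaled position (the generic points, where the walk is canonical).
[cite: Jozsa2003, §10 Prop. 36 (iii)] -/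
def refSet (N s₀ T M : ℕ) (V : ℤ) (m : ℤ) : Set ℤ :=
  {v | 0 ≤ v ∧ v ≤ V ∧ ((N : ℝ) * G.P m < v ∧ (v : ℝ) < N * G.P (m + 1)) ∧
    ∀ m', (N : ℝ) * G.Etot s₀ T (2 * M) < |(v : ℝ) - N * G.P m'|}

/-- **The anchor of stretch `m`**: `⌈N d̂⌉` of the walk to any reference point of the stretch (all
give the same walk, `final_eq_of_generic_grid`), or `⌈N P m⌉` if the stretch has none.
[cite: Jozsa2003, §9 Thm. 5, §10 Prop. 36] -/
def anchorOf (N s₀ T M : ℕ) (V : ℤ) (m : ℤ) : ℤ :=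
  if h : (G.refSet N s₀ T M V m).Nonempty then
    ⌈(N : ℚ) * (G.final ((h.some : ℚ) / N) s₀ T (2 * M)).2⌉
  else ⌈(N : ℝ) * G.P m⌉

/-- The ceiling of `N q` is within `N E + 1` of `N p` when `|q − p| ≤ E`. [folklore] -/
theorem abs_ceil_sub_le {N : ℕ} {q : ℚ} {p E : ℝ} (h : |(q : ℝ) - p| ≤ E) :
    |((⌈(N : ℚ) * q⌉ : ℤ) : ℝ) - N * p| ≤ N * E + 1 := by
  have hceil := Int.ceil_lt_add_one ((N : ℚ) * q)
  have hceil' := Int.le_ceil ((N : ℚ) * q)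
  have h1 : ((⌈(N : ℚ) * q⌉ : ℤ) : ℝ) < N * (q : ℝ) + 1 := by
    have : ((⌈(N : ℚ) * q⌉ : ℚ) : ℝ) < (((N : ℚ) * q + 1 : ℚ) : ℝ) := by exact_mod_cast hceil
    push_cast at this; exact this
  have h2 : (N : ℝ) * (q : ℝ) ≤ ((⌈(N : ℚ) * q⌉ : ℤ) : ℝ) := by
    have : (((N : ℚ) * q : ℚ) : ℝ) ≤ ((⌈(N : ℚ) * q⌉ : ℚ) : ℝ) := by exact_mod_cast hceil'
    push_cast at this; exact this
  have hN : (0 : ℝ) ≤ N := by positivity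
  rw [abs_le] at h ⊢
  have hlo := mul_le_mul_of_nonneg_left h.1 hN
  have hhi := mul_le_mul_of_nonneg_left h.2 hN
  constructor <;> nlinarith

/-- **Anchors are within `N E_tot + 1` of the scaled positions** (for adequate parameters).
[cite: Jozsa2003, §9 Thm. 5] -/
theorem abs_anchorOf_sub_le {N : ℕ} (hN : 0 < N) {s₀ T M : ℕ} {V : ℤ}
    (hV : ((V : ℝ) / N) ≤ (G.dbl s₀ T).2) (hM : G.Res s₀ T < M * (G.L - 2 * G.η)) (m : ℤ) :
    |((G.anchorOf N s₀ T M V m : ℤ) : ℝ) - N * G.P m| ≤ N * G.Etot s₀ T (2 * M) + 1 := by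
  have hNr : (0 : ℝ) < N := by exact_mod_cast hN
  have hE : 0 ≤ G.Etot s₀ T (2 * M) := by
    unfold Etot; have := G.Edesc_nonneg s₀ T 0; have := G.η_nonneg; positivity
  unfold anchorOf
  split_ifs with h
  · obtain ⟨hv0, hvV, hin, hgen⟩ := h.some_mem
    have hxT : ((h.some : ℝ) / N) ≤ (G.dbl s₀ T).2 := by
      refine le_trans ?_ hV
      apply div_le_div_of_nonneg_right _ hNr.le
      exact_mod_cast hvV
    obtain ⟨-, hd⟩ := G.table_exact hN hv0 hxT hM hin hgen
    exact abs_ceil_sub_le hd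
  · have h1 := Int.ceil_lt_add_one ((N : ℝ) * G.P m)
    have h2 := Int.le_ceil ((N : ℝ) * G.P m)
    rw [abs_le]
    have : (0 : ℝ) ≤ N * G.Etot s₀ T (2 * M) := by positivity
    constructor <;> linarith

/-! ### The blurred gap table of the walk -/

/-- The table, extended canonically outside `[0, V]` (where the quantum algorithm never reads it).
[cite: Jozsa2003, §10 (h̃_N)] -/
def tableExt {N : ℕ} (hN : 0 < N) (s₀ T M : ℕ) (V : ℤ) (v : ℤ) : ι × ℤ :=
  if 0 ≤ v ∧ v ≤ V then G.table N s₀ T (2 * M) v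
  else (G.lab (G.gridStretch hN v), v - G.anchorOf N s₀ T M V (G.gridStretch hN v))

/-- On `[0, V]` the extended table is the computed table. [folklore] -/
theorem tableExt_of_mem {N : ℕ} (hN : 0 < N) (s₀ T M : ℕ) {V v : ℤ} (hv0 : 0 ≤ v) (hvV : v ≤ V) :
    G.tableExt hN s₀ T M V v = G.table N s₀ T (2 * M) v := by
  simp [tableExt, hv0, hvV]

/-- **The computed table is a blurred gap table** (Jozsa's Prop. 36 for the honest table): pitch
`S = N R`, positions `N P`, blur radius `N E_tot`, anchor tolerance `N E_tot + 1`, for adequate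
parameters (`V/N ≤ d̂(I_T)`, `M(L − 2η) > Res`). [cite: Jozsa2003, §9 Thm. 5, §10 Prop. 36] -/
def blurred {N : ℕ} (hN : 0 < N) {s₀ T M : ℕ} {V : ℤ}
    (hV : ((V : ℝ) / N) ≤ (G.dbl s₀ T).2) (hM : G.Res s₀ T < M * (G.L - 2 * G.η)) :
    BlurredGapTable ι where
  S := N * G.R
  n := G.n
  P := fun m => N * G.P m
  lab := G.lab
  C := G.anchorOf N s₀ T M V
  e := N * G.Etot s₀ T (2 * M)
  w := N * G.Etot s₀ T (2 * M) + 1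
  F := G.tableExt hN s₀ T M V
  n_pos := G.n_pos
  strictMono := by
    have hNr : (0 : ℝ) < N := by exact_mod_cast hN
    exact fun a b hab => mul_lt_mul_of_pos_left (G.strictMono hab) hNr
  periodic := fun m => by simp only [G.periodic]; ring
  lab_eq_iff := G.lab_eq_iff
  e_nonneg := by
    have : 0 ≤ G.Etot s₀ T (2 * M) := by
      unfold Etot; have := G.Edesc_nonneg s₀ T 0; have := G.η_nonneg; positivity
    positivity
  anchor := G.abs_anchorOf_sub_le hN hV hM
  blur := by
    intro v
    have hNr : (0 : ℝ) < N := by exact_mod_cast hN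
    by_cases hv : 0 ≤ v ∧ v ≤ V
    · obtain ⟨m, c, hc, hF⟩ := G.table_blur N s₀ T (2 * M) v
      refine ⟨m, c, hc.trans ?_, by rw [tableExt, if_pos hv, hF]⟩
      have h := G.Edesc_add_le_Etot s₀ T (2 * M) (le_refl (2 * M))
      have hη := G.η_nonneg
      have hN0 : (0 : ℝ) ≤ N := by positivity
      push_cast at h ⊢
      nlinarith
    · refine ⟨G.gridStretch hN v, G.anchorOf N s₀ T M V (G.gridStretch hN v),
        G.abs_anchorOf_sub_le hN hV hM _, by rw [tableExt, if_neg hv]⟩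
  exact := by
    intro v m hgen h1 h2
    have hNr : (0 : ℝ) < N := by exact_mod_cast hN
    by_cases hv : 0 ≤ v ∧ v ≤ V
    · -- in range: the computed table, canonical by `final_eq_of_generic_grid`
      rw [tableExt, if_pos hv, table]
      have hxT : ((v : ℝ) / N) ≤ (G.dbl s₀ T).2 := by
        refine le_trans ?_ hV
        apply div_le_div_of_nonneg_right _ hNr.le
        exact_mod_cast hv.2
      obtain ⟨hlab, -⟩ := G.table_exact hN hv.1 hxT hM ⟨h1, h2⟩ hgen
      have href : (G.refSet N s₀ T M V m).Nonempty := ⟨v, hv.1, hv.2, ⟨h1, h2⟩, hgen⟩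
      have hanc : G.anchorOf N s₀ T M V m = ⌈(N : ℚ) * (G.final ((v : ℚ) / N) s₀ T (2 * M)).2⌉ := by
        rw [anchorOf, dif_pos href]
        obtain ⟨-, -, hin, hgen'⟩ := href.some_mem
        rw [G.final_eq_of_generic_grid hN hin ⟨h1, h2⟩ hgen' hgen]
      rw [hanc, hlab]
    · -- out of range: the canonical extension
      rw [tableExt, if_neg hv, G.gridStretch_eq hN h1.le h2]

/-- The table field of `blurred` is the computed table on `[0, V]`. [folklore] -/
theorem blurred_F_of_mem {N : ℕ} (hN : 0 < N) {s₀ T M : ℕ} {V : ℤ}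
    (hV : ((V : ℝ) / N) ≤ (G.dbl s₀ T).2) (hM : G.Res s₀ T < M * (G.L - 2 * G.η)) {v : ℤ}
    (hv0 : 0 ≤ v) (hvV : v ≤ V) :
    (G.blurred hN hV hM).F v = G.table N s₀ T (2 * M) v :=
  G.tableExt_of_mem hN s₀ T M hv0 hvV

/-! ### Consequences for the computed table -/

section Consequences

variable {N : ℕ} (hN : 0 < N) {s₀ T M : ℕ} {V : ℤ}
  (hV : ((V : ℝ) / N) ≤ (G.dbl s₀ T).2) (hM : G.Res s₀ T < M * (G.L - 2 * G.η))

/-- **The level set of a good start on `[0, Q)` is a comb**, for the computed table: with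
`Q ≤ V + 1`, a start `0 ≤ k ≤ V`, `k < S − 2w`, good for stretch `m₀` (in the sense of the blurred
table `G.blurred …`), `{v < Q | table v = table k}` is the image of `[0, p)` under the teeth, which
are strictly increasing and within `2w` of `k + lS` (`BlurredGapTable.abs_tooth_toNat_sub_le`,
`injOn_tooth_toNat`, `le_teethCount`). [cite: Jozsa2003, §10 Prop. 36, Thm. 6 (proof)] -/
theorem table_filter_range_eq_image {k m₀ : ℤ} (h : (G.blurred hN hV hM).IsGood k m₀) (hk0 : 0 ≤ k)
    (hkV : k ≤ V) (hk : (k : ℝ) < (G.blurred hN hV hM).S - 2 * (G.blurred hN hV hM).w)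
    {Q : ℕ} (hQ : (Q : ℤ) ≤ V + 1) :
    (range Q).filter (fun v : ℕ => G.table N s₀ T (2 * M) v = G.table N s₀ T (2 * M) k) =
      (range ((G.blurred hN hV hM).teethCount k m₀ Q)).image
        (fun l : ℕ => ((G.blurred hN hV hM).tooth k m₀ l).toNat) := by
  rw [← (G.blurred hN hV hM).filter_range_eq_image h hk0 hk Q]
  apply Finset.filter_congr
  intro v hv
  rw [mem_range] at hv
  rw [G.blurred_F_of_mem hN hV hM (by positivity) (by omega), G.blurred_F_of_mem hN hV hM hk0 hkV]

/-- **The computed table is one-to-one on good starts** less than `S − 2w` apart, within `[0, V]`.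
[cite: Jozsa2003, §10 Prop. 36 (i)] -/
theorem table_injOn_of_good (A : Set ℤ) (hA : ∀ k ∈ A, 0 ≤ k ∧ k ≤ V ∧ ∃ m₀, (G.blurred hN hV hM).IsGood k m₀)
    (hdiam : ∀ k ∈ A, ∀ k' ∈ A, |(k' : ℝ) - k| < (G.blurred hN hV hM).S - 2 * (G.blurred hN hV hM).w) :
    Set.InjOn (G.table N s₀ T (2 * M)) A := by
  intro k hk k' hk' hF
  obtain ⟨hk0, hkV, hgood⟩ := hA k hk
  obtain ⟨hk0', hkV', -⟩ := hA k' hk'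
  have hinj := (G.blurred hN hV hM).injOn_of_good A (fun k hk => (hA k hk).2.2) hdiam
  apply hinj hk hk'
  rw [G.blurred_F_of_mem hN hV hM hk0 hkV, G.blurred_F_of_mem hN hV hM hk0' hkV', hF]

end Consequences

end GiantStepCycle

end Literature.Computability.Cryptography

end
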